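import Summits.BirchSwinnertonDyer.BirchSwinnertonDyer.Theorems.ResidualThetaTransportAtTwoResidualSignedLambdaLowerCMAtTwoStationRValVisible
import HarnessLib

/-!
# Sketch v2 (stub-ideation k = 4, gen 32, technique «assume the opposite») — crux `ResidualThetaCountLowerPureAtTwo`
# (stmt-BirchSwinnertonDyer-26074), stub `stub_cmLambdaLower` (= RSL_g, closed mod print since v8; skeleton v9; one research leaf `stub_kzgChildB`)

TRAP AUDIT of the newest typed station under the stub — k1-g34's (T4) `RatioRelationStatement` (Sketch_sidea_k1_g34, 17:38Z) — by
ASSUMING THE OPPOSITE at the only place where its binder is wider than everything landed: (T4) quantifies a BARE index family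
`τ : ∀ m, ZMod (2^m) → G_{ℚ₂}` (and a bare `Φ`), whereas the ∀-child-B leaf (`stub_kzgChildB`, v9), station (R) `OnePair.stub_kzgValueRelation`
(p725106) and `StationR.values_identity` all bind a FRAME `F : π.KatoFrame` (`τ_{m,a} ζ_{2^m} = ζ_{2^m}^a`).  Small cases of non-frame `τ`, in kernel:

* §1/§2 (i) UNIT RE-INDEXING `τ ↦ τ ∘ (u·)`: (BKρ), (TRIVρ) are invariant (plain Galois sums), the (VALρ) sums pick up `ψ(u)`
  (`inv_apply_mul_sum_reindex`); for `u = −1` and even `ψ` nothing moves, so `KatoValuedClass … (τ∘neg) … ↔ KatoValuedClass … τ …`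
  (`katoValuedClass_reindex_neg_iff`, PROVED) although `τ∘neg` is NEVER a frame when `τ` is: (T4)'s extra generality is partly costume
  (the orbit of the frames under `τ ↦ τ∘(u·)` carries the same classes up to `μ̃ ↦ (1+T)^k μ̃` for `u_m = 5^k`), no counterexample there.
* §2 (ii) DEGENERATE `τ` (constant on units at the even levels): every (VALρ) left-hand side vanishes (`Σ_{b} ψ⁻¹(b) = 0`, `ψ ≠ 1`), so by the
  LANDED Pollack rigidity `ThetaTransport.StationRValVisible.not_katoValuedClass_of_valInvisible` (k3 seat) there is NO valued class at such `τ`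
  (`not_katoValuedClass_of_tau_const`, PROVED mod its displayed (H-RIG) + even congruences = RSL_g's own binder): (T4) is vacuously true there.
  Same for any `τ_k` invariant under `b ↦ h·b` with `ψ(h) ≠ 1` (`twistedSum_eq_zero_of_invariant`; `h = 1 + 2^{m+1}` kills EVERY primitive `ψ`).
* §2 (iii) THE ODD GAUGE (G7) — a solution-set generator k4-g31's census MISSED: `w ↦ w + d` with `τ_{−b}•d = −τ_b•d` preserves (VALρ) and
  (TRIVρ) in kernel (`katoValCoord_add_odd`, `katoTrivCoord_add_odd`, PROVED) and (BKρ) whenever the logarithms are `τ`-even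
  (`katoBKCoord_add_odd`, PROVED from the displayed evenness; at a frame the evenness IS the tree's `KatoBK.tau_neg_smul_ptLogΩ_eq`).
  Harmless at frames (μ̃ untouched) — but at a SCRAMBLED bijective re-indexing `τ∘π` (π not ±-equivariant) the odd gauge of `τ` feeds the
  even-character sums of `τ∘π`, so existence / ratio of valued classes there is hostage to linear relations among the twisted values
  `{L(g,ψ,1)}`: (T4) over all `τ` is TRUE-looking but MIS-CUT (no proof route; none needed).
* §3 REPAIR, typed: `RatioRelationAtFrames` (= (T4) with `F : π.KatoFrame`), and `ratioRelationAtFrames_of_allTau` (PROVED): k1-g34's consumers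
  (`childB_pair_of_witness`, `…_of_sharpR`, `…_of_constUnitR`) only ever instantiate (T4) at the frame of the two classes, so nothing is lost, and
  the frame version is exactly what k1-g31 PLAN 1 steps 3–5 prove (two calls of `values_identity` + (Θ) + (P) `finite_setOf_tsum_eq_zero`).

v1 of this file (17:37Z: (VDET)/(HEV)/(NVK)/(IDP) + `multiplierLambdaPinned_of`) is WITHDRAWN as content: it re-derived what the landed
`StationR.values_identity` (R4b; its proof instantiates (BKρ) at EVERY even layer `2m` — k4-g31's «layer leak» is closed by citation, not by a lemma)
and k1-g31's stations (U)/(Θ)/(P) already give.  THEOREMS + Prop-valued defs only; no `sorry`, no axiom, no instance, no notation.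
BSD is NOT proved by anything here; items 26074 / 22608 stay OPEN, 24105 HOLD.
-/

set_option autoImplicit false
set_option linter.dupNamespace false
set_option backward.isDefEq.respectTransparency false

noncomputable section

open scoped Classical NumberField

open Polynomial
open Literature.NumberTheory.EllipticCurves Literature.NumberTheory.EllipticCurves.GreenbergSelmer
open Literature.NumberTheory.EllipticCurves.ModularForms
open Literature.NumberTheory.GaloisRepresentations NumberField IsDedekindDomain Field
open GreenbergVatsal2000 Kobayashi2003 Rat.HeightOneSpectrum
open Literature.NumberTheory.EllipticCurves.FormalGroupChart
open Summit.BirchSwinnertonDyer.Rank1Residual.Additive Summit.BirchSwinnertonDyer.Rank1Residual.Additive.PadicCyclotomicTower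
  Summit.BirchSwinnertonDyer.Rank1Residual.Additive.BallEval
open Summit.BirchSwinnertonDyer.BirchSwinnertonDyer.Theorems.SignedKatoOffTwo
  Summit.BirchSwinnertonDyer.BirchSwinnertonDyer.Theorems.SignedKatoOffTwo.LocalTwo
open Summit.BirchSwinnertonDyer.BirchSwinnertonDyer.Theorems.OnePair
open Summit.BirchSwinnertonDyer.BirchSwinnertonDyer.Theorems

namespace Summit.BirchSwinnertonDyer.BirchSwinnertonDyer.Cruxes.ResidualThetaCountLowerPureAtTwo.SideaK4G32

/-! ## §1 Kernel: re-indexing and parity of sums over `(ℤ/N)ˣ` (helper lemmas H1–H7 of the card) -/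

section Kernel

variable {N : ℕ} [NeZero N] {K : Type*} [Field K]

/-- **H1** re-indexing a sum over `(ℤ/N)ˣ` by left multiplication with a unit. -/
theorem sum_units_comp_mul {A : Type*} [AddCommMonoid A] (u : (ZMod N)ˣ) (f : (ZMod N)ˣ → A) :
    ∑ b, f (u * b) = ∑ b, f b :=
  Fintype.sum_equiv (Equiv.mulLeft u) _ _ fun _ => rfl

/-- **H1′** re-indexing by negation. -/
theorem sum_units_comp_neg {A : Type*} [AddCommMonoid A] (f : (ZMod N)ˣ → A) : ∑ b, f (-b) = ∑ b, f b :=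
  Fintype.sum_equiv (Equiv.neg _) _ _ fun _ => rfl

/-- **H2** an odd function on `(ℤ/N)ˣ` with values in a `K`-module, `char K ≠ 2`, sums to zero. -/
theorem sum_units_eq_zero_of_odd {A : Type*} [AddCommGroup A] [Module K A] (h2 : (2 : K) ≠ 0)
    (o : (ZMod N)ˣ → A) (ho : ∀ b, o (-b) = -o b) : ∑ b, o b = 0 := by
  have h : ∑ b, o b = -∑ b, o b := by
    calc ∑ b, o b = ∑ b, o (-b) := (sum_units_comp_neg o).symm
      _ = ∑ b, -o b := Finset.sum_congr rfl fun b _ => ho b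
      _ = -∑ b, o b := Finset.sum_neg_distrib _
  have h2S : (2 : K) • ∑ b, o b = 0 := by
    rw [two_smul]
    nth_rewrite 2 [h]
    exact add_neg_cancel _
  exact (smul_eq_zero.mp h2S).resolve_left h2

omit [NeZero N] in
/-- **H3** an even character is even after inversion: `ψ(−1) = 1 ⟹ ψ⁻¹(−x) = ψ⁻¹(x)`. -/
theorem inv_apply_neg_of_even (ψ : MulChar (ZMod N) K) (hev : ψ (-1) = 1) (x : ZMod N) : ψ⁻¹ (-x) = ψ⁻¹ x := by
  rw [neg_eq_neg_one_mul, map_mul, MulChar.inv_apply_eq_inv', hev, inv_one, one_mul]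

/-- **H4** the twisted re-indexing law: `ψ⁻¹(u) · Σ_b ψ⁻¹(b) T(u·b) = Σ_b ψ⁻¹(b) T(b)` — the (VALρ) sums of the re-indexed family
`τ ∘ (u·)` are `ψ(u)` times those of `τ`. -/
theorem inv_apply_mul_sum_reindex {A : Type*} [AddCommGroup A] [Module K A] (ψ : MulChar (ZMod N) K) (u : (ZMod N)ˣ)
    (T : ZMod N → A) :
    ψ⁻¹ (u : ZMod N) • ∑ b : (ZMod N)ˣ, ψ⁻¹ (b : ZMod N) • T ((u : ZMod N) * b) = ∑ b : (ZMod N)ˣ, ψ⁻¹ (b : ZMod N) • T b := by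
  rw [Finset.smul_sum]
  calc ∑ b : (ZMod N)ˣ, ψ⁻¹ (u : ZMod N) • ψ⁻¹ (b : ZMod N) • T ((u : ZMod N) * b)
        = ∑ b : (ZMod N)ˣ, (fun b' : (ZMod N)ˣ => ψ⁻¹ (b' : ZMod N) • T b') (u * b) :=
          Finset.sum_congr rfl fun b _ => by rw [smul_smul, ← map_mul]; simp only [Units.val_mul]
    _ = ∑ b : (ZMod N)ˣ, ψ⁻¹ (b : ZMod N) • T b := sum_units_comp_mul u (fun b' : (ZMod N)ˣ => ψ⁻¹ (b' : ZMod N) • T b')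

/-- **H5** a non-trivial multiplicative character sums to zero over the units. -/
theorem sum_units_mulChar_eq_zero (χ : MulChar (ZMod N) K) (hχ : χ ≠ 1) : ∑ b : (ZMod N)ˣ, χ (b : ZMod N) = 0 := by
  obtain ⟨u, hu⟩ : ∃ u : (ZMod N)ˣ, χ (u : ZMod N) ≠ 1 := by
    by_contra h
    push Not at h
    exact hχ (MulChar.ext fun a => by rw [h a, MulChar.one_apply_coe])
  have key : χ (u : ZMod N) * ∑ b : (ZMod N)ˣ, χ (b : ZMod N) = ∑ b : (ZMod N)ˣ, χ (b : ZMod N) := by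
    rw [Finset.mul_sum]
    calc ∑ b : (ZMod N)ˣ, χ (u : ZMod N) * χ (b : ZMod N) = ∑ b : (ZMod N)ˣ, (fun b' : (ZMod N)ˣ => χ (b' : ZMod N)) (u * b) :=
          Finset.sum_congr rfl fun b _ => by rw [← map_mul]; simp only [Units.val_mul]
      _ = ∑ b : (ZMod N)ˣ, χ (b : ZMod N) := sum_units_comp_mul u (fun b' : (ZMod N)ˣ => χ (b' : ZMod N))
  have h1 : (χ (u : ZMod N) - 1) * ∑ b : (ZMod N)ˣ, χ (b : ZMod N) = 0 := by rw [sub_mul, one_mul, key, sub_self]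
  exact (mul_eq_zero.mp h1).resolve_left (sub_ne_zero.mpr hu)

/-- **H5′** a primitive Dirichlet character of level `N ≠ 1` is not trivial, and neither is its inverse. -/
theorem inv_ne_one_of_isPrimitive (hN1 : N ≠ 1) (ψ : DirichletCharacter K N) (hprim : ψ.IsPrimitive) : ψ⁻¹ ≠ 1 := by
  rw [Ne, inv_eq_one]
  rintro rfl
  rw [DirichletCharacter.isPrimitive_def, DirichletCharacter.conductor_one] at hprim
  exact hN1 hprim.symm

/-- **H6** INVARIANCE KILLS THE TWISTED SUM: if `T(h·b) = T(b)` for a unit `h` with `ψ⁻¹(h) ≠ 1` then `Σ_b ψ⁻¹(b) T(b) = 0`.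
(Used with `T = (b ↦ τ_b • w)`: a constant `τ` (`h` arbitrary), or `τ ∘ π` with `π(h·b) = π(b)`; `h = 1 + 2^{m+1}` has `ψ(h) = −1` for EVERY
primitive `ψ` mod `2^{m+2}` since `5^{2^{m-1}} ≡ 1 + 2^{m+1}` and `ψ(5)` has exact order `2^m` — tree `isPrimitiveRoot_apply_five`.) -/
theorem twistedSum_eq_zero_of_invariant {A : Type*} [AddCommGroup A] [Module K A] (ψ : MulChar (ZMod N) K) (h : (ZMod N)ˣ)
    (hψh : ψ⁻¹ (h : ZMod N) ≠ 1) (T : ZMod N → A) (hT : ∀ b : (ZMod N)ˣ, T ((h : ZMod N) * b) = T b) :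
    ∑ b : (ZMod N)ˣ, ψ⁻¹ (b : ZMod N) • T b = 0 := by
  have key := inv_apply_mul_sum_reindex ψ h T
  simp only [hT] at key
  have h1 : (ψ⁻¹ (h : ZMod N) - 1) • ∑ b : (ZMod N)ˣ, ψ⁻¹ (b : ZMod N) • T b = 0 := by rw [sub_smul, one_smul, key, sub_self]
  exact (smul_eq_zero.mp h1).resolve_left (sub_ne_zero.mpr hψh)

/-- **H7** the odd gauge is invisible to even characters: `ψ` even, `o` odd ⟹ `Σ_b ψ⁻¹(b) • o(b) = 0`. -/
theorem twistedSum_eq_zero_of_odd {A : Type*} [AddCommGroup A] [Module K A] (h2 : (2 : K) ≠ 0) (ψ : MulChar (ZMod N) K)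
    (hev : ψ (-1) = 1) (o : (ZMod N)ˣ → A) (ho : ∀ b, o (-b) = -o b) :
    ∑ b : (ZMod N)ˣ, ψ⁻¹ (b : ZMod N) • o b = 0 :=
  sum_units_eq_zero_of_odd h2 _ fun b => by rw [Units.val_neg, inv_apply_neg_of_even ψ hev, ho, smul_neg]

end Kernel

/-! ## §2 The trap table over the tree's texts `OnePairPins.KatoBKCoord / KatoValCoord / KatoTrivCoord / KatoValuedClass` (VERBATIM) -/

section Tree

variable {S : Set (PadicAlgCl 2)} {W : WeierstrassCurve ℚ} [W.IsElliptic] {κ : ZpExtension ℚ 2} {γ : absoluteGaloisGroup ℚ}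
  {S₀ : Finset (HeightOneSpectrum (𝓞 ℚ))} {n : ℕ} {ρ : FramedGaloisRep ℚ ↥(padicCoeffIntegers S) 2}
  {Θ : ∀ v : HeightOneSpectrum (𝓞 ℚ), ((2 : ℕ) : 𝓞 ℚ) ∈ v.asIdeal → (Cofree ρ ↥(padicCoeffField S) ≃+ (Fin n → ↥(W.geomPrimaryTorsion 2)))}
  {hΘ : ∀ v hv (δ : absoluteGaloisGroup (v.adicCompletion ℚ)) m i,
    Θ v hv (resGalOfEmb (closureEmb (K := ℚ) (v.adicCompletion ℚ)) δ • m) i = resGalOfEmb (closureEmb (K := ℚ) (v.adicCompletion ℚ)) δ • Θ v hv m i}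
  {I : Kato2004.IwasawaH1DataCoeff (FramedGaloisRep.toGaloisRep ρ) 2 κ γ}
  {Sg : AddSubgroup (subgroupH1 κ.kerSubgroup (Cofree ρ ↥(padicCoeffField S)))} [Module ↥(padicCoeffIntegers S) ↥Sg]
  (π : OnePairPins S W κ γ S₀ n ρ Θ hΘ I Sg)
  {M : ℕ} [NeZero M] (g : CuspForm (CongruenceSubgroup.Gamma0 M) 2) (ι : ModularForms.coeffField g →+* PadicAlgCl 2) (Ω : ℂ)

/-! ### (i) re-indexing by `−1`: a non-frame with exactly the same classes -/

/-- (TRIVρ) is invariant under `τ ↦ τ∘neg` (plain Galois sums; re-index `b ↦ −b`). -/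
theorem katoTrivCoord_reindex_neg {τ : ∀ m : ℕ, ZMod (2 ^ m) → Field.absoluteGaloisGroup ℚ_[2]}
    {w : ℕ → Fin π.nb → PadicAlgCl 2} {q : PadicAlgCl 2} {μt : IwasawaAlgebraO S} (h : π.KatoTrivCoord g ι Ω τ w q μt) :
    π.KatoTrivCoord g ι Ω (fun k c => τ k (-c)) w q μt := by
  intro k hk hk3
  rw [← h k hk hk3]
  refine Finset.sum_congr rfl fun j _ => ?_
  congr 1
  symm
  exact Fintype.sum_equiv (Equiv.neg _) _ _ fun b => by simp only [Equiv.neg_apply, Units.val_neg, neg_neg]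

/-- (BKρ) is invariant under `τ ↦ τ∘neg` (plain Galois sums; the logarithm factor does not depend on `b`). -/
theorem katoBKCoord_reindex_neg [W.IsGloballyMinimal] {Φ : AlgebraicClosure ℚ_[2] ≃ₐ[ℚ] AlgebraicClosure (π.v.adicCompletion ℚ)}
    {τ : ∀ m : ℕ, ZMod (2 ^ m) → Field.absoluteGaloisGroup ℚ_[2]} {z : I.H} {c' : Fin n → ↥(padicCoeffIntegers S)}
    {w : ℕ → Fin π.nb → PadicAlgCl 2} (h : π.KatoBKCoord Φ τ z c' w) : π.KatoBKCoord Φ (fun k c => τ k (-c)) z c' w := by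
  intro a m i Q₀ hQv hker
  rw [h a m i Q₀ hQv hker]
  refine Finset.sum_congr rfl fun j _ => ?_
  congr 1
  symm
  exact Fintype.sum_equiv (Equiv.neg _) _ _ fun b => by simp only [Equiv.neg_apply, Units.val_neg]

/-- (VALρ) is invariant under `τ ↦ τ∘neg` (it only tests EVEN `ψ`: `ψ⁻¹(−b) = ψ⁻¹(b)`, H3). -/
theorem katoValCoord_reindex_neg {τ : ∀ m : ℕ, ZMod (2 ^ m) → Field.absoluteGaloisGroup ℚ_[2]}
    {w : ℕ → Fin π.nb → PadicAlgCl 2} {q : PadicAlgCl 2} {μt : IwasawaAlgebraO S} (h : π.KatoValCoord g ι Ω τ w q μt) :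
    π.KatoValCoord g ι Ω (fun k c => τ k (-c)) w q μt := by
  intro m ψ hev hprim
  rw [← h m ψ hev hprim]
  congr 2
  refine Finset.sum_congr rfl fun j _ => ?_
  congr 1
  symm
  exact Fintype.sum_equiv (Equiv.neg _) _ _ fun b => by
    simp only [Equiv.neg_apply, Units.val_neg, neg_neg, inv_apply_neg_of_even ψ hev]

/-- **(i) PROVED: the valued classes at `τ` and at `τ∘neg` are THE SAME** — and `τ∘neg` violates `KatoFrame.hτ` whenever `τ` satisfies it
(`(τ∘neg)_{2,1} ζ₄ = ζ₄³ ≠ ζ₄`), so (T4)'s bare-`τ` binder ranges over genuine non-frames without producing anything new there. -/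
theorem katoValuedClass_reindex_neg_iff [W.IsGloballyMinimal] (Φ : AlgebraicClosure ℚ_[2] ≃ₐ[ℚ] AlgebraicClosure (π.v.adicCompletion ℚ))
    (τ : ∀ m : ℕ, ZMod (2 ^ m) → Field.absoluteGaloisGroup ℚ_[2]) (z : I.H) (c' : Fin n → ↥(padicCoeffIntegers S))
    (w : ℕ → Fin π.nb → PadicAlgCl 2) (q : PadicAlgCl 2) (μt : IwasawaAlgebraO S) :
    π.KatoValuedClass g ι Ω Φ (fun k c => τ k (-c)) z c' w q μt ↔ π.KatoValuedClass g ι Ω Φ τ z c' w q μt := by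
  have back : ∀ τ' : ∀ m : ℕ, ZMod (2 ^ m) → Field.absoluteGaloisGroup ℚ_[2],
      π.KatoValuedClass g ι Ω Φ τ' z c' w q μt → π.KatoValuedClass g ι Ω Φ (fun k c => τ' k (-c)) z c' w q μt :=
    fun τ' hc => ⟨hc.1, hc.2.1, hc.2.2.1, katoBKCoord_reindex_neg π hc.2.2.2.1, katoValCoord_reindex_neg π g ι Ω hc.2.2.2.2.1,
      katoTrivCoord_reindex_neg π g ι Ω hc.2.2.2.2.2⟩
  refine ⟨fun hc => ?_, back τ⟩
  have e : (fun k c => (fun k c => τ k (-c)) k (-c)) = τ := by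
    funext k c
    simp only [neg_neg]
  have h' := back _ hc
  rw [e] at h'
  exact h'

/-! ### (ii) degenerate index families: no valued class at all (Pollack rigidity, landed) -/

/-- The (VALρ) left-hand side VANISHES identically when `τ_{m+2}` is constant on the units (H5, H5′: `Σ_b ψ⁻¹(b) = 0` for primitive `ψ`). -/
theorem valLHS_eq_zero_of_tau_const {τ : ∀ m : ℕ, ZMod (2 ^ m) → Field.absoluteGaloisGroup ℚ_[2]}
    (hτ : ∀ (m : ℕ) (b b' : (ZMod (2 ^ (m + 2)))ˣ), τ (m + 2) (b : ZMod (2 ^ (m + 2))) = τ (m + 2) (b' : ZMod (2 ^ (m + 2))))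
    (w : ℕ → Fin π.nb → PadicAlgCl 2) (m : ℕ) (ψ : DirichletCharacter (PadicAlgCl 2) (2 ^ (m + 2))) (hprim : ψ.IsPrimitive) :
    ∑ j : Fin π.nb, ((π.bO j : ↥(padicCoeffIntegers S)) : PadicAlgCl 2) *
        ∑ b : (ZMod (2 ^ (m + 2)))ˣ, ψ⁻¹ (b : ZMod (2 ^ (m + 2))) * τ (m + 2) (b : ZMod (2 ^ (m + 2))) • w (m + 2) j = 0 := by
  haveI : NeZero (2 ^ (m + 2)) := ⟨pow_ne_zero _ two_ne_zero⟩
  have hN1 : 2 ^ (m + 2) ≠ 1 := by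
    have : 4 ≤ 2 ^ (m + 2) := by
      calc (4 : ℕ) = 2 ^ 2 := by norm_num
        _ ≤ 2 ^ (m + 2) := Nat.pow_le_pow_right (by norm_num) (by omega)
    omega
  refine Finset.sum_eq_zero fun j _ => ?_
  have hc : ∑ b : (ZMod (2 ^ (m + 2)))ˣ, ψ⁻¹ (b : ZMod (2 ^ (m + 2))) * τ (m + 2) (b : ZMod (2 ^ (m + 2))) • w (m + 2) j =
      (∑ b : (ZMod (2 ^ (m + 2)))ˣ, ψ⁻¹ (b : ZMod (2 ^ (m + 2)))) * τ (m + 2) ((1 : (ZMod (2 ^ (m + 2)))ˣ) : ZMod (2 ^ (m + 2))) • w (m + 2) j := by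
    rw [Finset.sum_mul]
    exact Finset.sum_congr rfl fun b _ => by rw [hτ m b 1]
  rw [hc, sum_units_mulChar_eq_zero _ (inv_ne_one_of_isPrimitive hN1 ψ hprim), zero_mul, mul_zero]

/-- **(ii) PROVED (mod the displayed (H-RIG) + even congruences, = RSL_g's own Pollack-pair binder): NO valued class at a degenerate `τ`.**
So (T4) holds VACUOUSLY on this part of its binder — the «opposite» (a class with a free multiplier `μ̃`) cannot even be instantiated.
Engine: the k3 seat's landed `ThetaTransport.StationRValVisible.not_katoValuedClass_of_valInvisible`. [cite: Pollack2003, Cor. 5.11, Prop. 6.18 (proof)]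
[cite: Kato2004Asterisque, Thm. 12.5 (1) (pp. 221–222)] -/
theorem not_katoValuedClass_of_tau_const [W.IsGloballyMinimal]
    {Lm : IwasawaAlgebraO S} (hLm : Lm ≠ 0)
    (hcong : ∀ N : ℕ, Even N →
      IsCongrModOmegaO S N ((mazurTateElementK g Ω 2 N).map ι)
        (((((-1 : ℤ[X]) ^ (N / 2 + 1) * cyclotomicOmegaMinus 2 N).map (Int.castRingHom (PadicAlgCl 2)) : (PadicAlgCl 2)[X]) :
            PowerSeries (PadicAlgCl 2)) * iwasawaOToPowerSeries S Lm))
    (hRIG : ∀ (G : IwasawaAlgebraO S) (ℓ : ℕ → ℕ), (∀ m : ℕ, ∃ i, m < ℓ i) →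
      (∀ (i : ℕ) (ζ : ℂ_[2]), IsPrimitiveRoot ζ (2 ^ (ℓ i + 1)) →
        ∑' k, ((algebraMap (PadicAlgCl 2) ℂ_[2]).comp (padicCoeffIntegers S).subtype) (PowerSeries.coeff k G) * (ζ - 1) ^ k = 0) →
      G = 0)
    (Φ : AlgebraicClosure ℚ_[2] ≃ₐ[ℚ] AlgebraicClosure (π.v.adicCompletion ℚ))
    (τ : ∀ m : ℕ, ZMod (2 ^ m) → Field.absoluteGaloisGroup ℚ_[2])
    (hτ : ∀ (m : ℕ) (b b' : (ZMod (2 ^ (m + 2)))ˣ), τ (m + 2) (b : ZMod (2 ^ (m + 2))) = τ (m + 2) (b' : ZMod (2 ^ (m + 2))))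
    (z : I.H) (c' : Fin n → ↥(padicCoeffIntegers S)) (w : ℕ → Fin π.nb → PadicAlgCl 2) (q : PadicAlgCl 2) (μt : IwasawaAlgebraO S) :
    ¬ π.KatoValuedClass g ι Ω Φ τ z c' w q μt :=
  ThetaTransport.StationRValVisible.not_katoValuedClass_of_valInvisible g ι Ω π hLm hcong hRIG Φ τ z c' w q μt fun m ψ _ hprim _ =>
    valLHS_eq_zero_of_tau_const π hτ w m ψ hprim

/-- The general degeneration (H6 at the texts): if `τ_{m+2} ∘ (h·) = τ_{m+2}` for a unit `h` with `ψ⁻¹(h) ≠ 1`, the (VALρ) left-hand side at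
`ψ` vanishes.  With `h = 1 + 2^{m+1}` (order two, `ψ(h) = −1` for all primitive `ψ`) this covers `τ ∘ sq` and every index map through
`(ℤ/2^{m+2})ˣ/⟨1 + 2^{m+1}⟩`; `not_katoValuedClass_of_valInvisible` then excludes valued classes exactly as above. -/
theorem valLHS_eq_zero_of_invariant {τ : ∀ m : ℕ, ZMod (2 ^ m) → Field.absoluteGaloisGroup ℚ_[2]} (w : ℕ → Fin π.nb → PadicAlgCl 2)
    (m : ℕ) (ψ : DirichletCharacter (PadicAlgCl 2) (2 ^ (m + 2))) (h : (ZMod (2 ^ (m + 2)))ˣ)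
    (hψh : ψ⁻¹ (h : ZMod (2 ^ (m + 2))) ≠ 1)
    (hτ : ∀ b : (ZMod (2 ^ (m + 2)))ˣ, τ (m + 2) ((h : ZMod (2 ^ (m + 2))) * b) = τ (m + 2) (b : ZMod (2 ^ (m + 2)))) :
    ∑ j : Fin π.nb, ((π.bO j : ↥(padicCoeffIntegers S)) : PadicAlgCl 2) *
        ∑ b : (ZMod (2 ^ (m + 2)))ˣ, ψ⁻¹ (b : ZMod (2 ^ (m + 2))) * τ (m + 2) (b : ZMod (2 ^ (m + 2))) • w (m + 2) j = 0 := by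
  haveI : NeZero (2 ^ (m + 2)) := ⟨pow_ne_zero _ two_ne_zero⟩
  refine Finset.sum_eq_zero fun j _ => ?_
  have h0 := twistedSum_eq_zero_of_invariant (A := PadicAlgCl 2) ψ h hψh (fun x => τ (m + 2) x • w (m + 2) j) fun b => by
    simp only [hτ b]
  simp only [smul_eq_mul] at h0
  rw [h0, mul_zero]

/-! ### (iii) the odd gauge (G7): `w ↦ w + d`, `τ_{−b}•d = −τ_b•d` -/

/-- (VALρ) is invariant under the odd gauge (H7: even `ψ` do not see odd functions of `b`). -/
theorem katoValCoord_add_odd {τ : ∀ m : ℕ, ZMod (2 ^ m) → Field.absoluteGaloisGroup ℚ_[2]}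
    {w d : ℕ → Fin π.nb → PadicAlgCl 2} {q : PadicAlgCl 2} {μt : IwasawaAlgebraO S}
    (hd : ∀ (k : ℕ) (b : (ZMod (2 ^ k))ˣ) (j : Fin π.nb), τ k (-(b : ZMod (2 ^ k))) • d k j = -(τ k (b : ZMod (2 ^ k)) • d k j))
    (h : π.KatoValCoord g ι Ω τ w q μt) : π.KatoValCoord g ι Ω τ (w + d) q μt := by
  intro m ψ hev hprim
  haveI : NeZero (2 ^ (m + 2)) := ⟨pow_ne_zero _ two_ne_zero⟩
  rw [← h m ψ hev hprim]
  congr 2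
  refine Finset.sum_congr rfl fun j _ => ?_
  congr 1
  have h0 := twistedSum_eq_zero_of_odd (A := PadicAlgCl 2) (two_ne_zero' (PadicAlgCl 2)) ψ hev
    (fun b : (ZMod (2 ^ (m + 2)))ˣ => τ (m + 2) (b : ZMod (2 ^ (m + 2))) • d (m + 2) j) fun b => by
      simp only [Units.val_neg, hd]
  simp only [smul_eq_mul] at h0
  simp only [Pi.add_apply, smul_add, mul_add, Finset.sum_add_distrib, h0, add_zero]

/-- (TRIVρ) is invariant under the odd gauge (H2: odd functions of `b` sum to zero). -/
theorem katoTrivCoord_add_odd {τ : ∀ m : ℕ, ZMod (2 ^ m) → Field.absoluteGaloisGroup ℚ_[2]}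
    {w d : ℕ → Fin π.nb → PadicAlgCl 2} {q : PadicAlgCl 2} {μt : IwasawaAlgebraO S}
    (hd : ∀ (k : ℕ) (b : (ZMod (2 ^ k))ˣ) (j : Fin π.nb), τ k (-(b : ZMod (2 ^ k))) • d k j = -(τ k (b : ZMod (2 ^ k)) • d k j))
    (h : π.KatoTrivCoord g ι Ω τ w q μt) : π.KatoTrivCoord g ι Ω τ (w + d) q μt := by
  intro k hk hk3
  haveI : NeZero (2 ^ k) := ⟨pow_ne_zero _ two_ne_zero⟩
  rw [← h k hk hk3]
  refine Finset.sum_congr rfl fun j _ => ?_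
  congr 1
  have h0 := sum_units_eq_zero_of_odd (A := PadicAlgCl 2) (two_ne_zero' (PadicAlgCl 2))
    (fun b : (ZMod (2 ^ k))ˣ => τ k (b : ZMod (2 ^ k)) • d k j) fun b => by simp only [Units.val_neg, hd]
  simp only [Pi.add_apply, smul_add, Finset.sum_add_distrib, h0, add_zero]

/-- (BKρ) is invariant under the odd gauge WHENEVER THE LOGARITHMS ARE `τ`-EVEN (displayed hypothesis `hlog`, stated on (BKρ)'s own binder).
At a frame `F` the evenness is the tree's `KatoBK.tau_neg_smul_ptLogΩ_eq` (the formal points of `W(ℚ_{2,m})` have logarithms in the PLUS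
field `ℚ₂(ζ + ζ⁻¹)`, fixed by `τ_{−1}`) after the `Φ`-transport that `StationR.values_identity` performs; for a NON-frame `τ` it is false in
general — which is the point of (iii). -/
theorem katoBKCoord_add_odd [W.IsGloballyMinimal] {Φ : AlgebraicClosure ℚ_[2] ≃ₐ[ℚ] AlgebraicClosure (π.v.adicCompletion ℚ)}
    {τ : ∀ m : ℕ, ZMod (2 ^ m) → Field.absoluteGaloisGroup ℚ_[2]} {z : I.H} {c' : Fin n → ↥(padicCoeffIntegers S)}
    {w d : ℕ → Fin π.nb → PadicAlgCl 2}
    (hd : ∀ (k : ℕ) (b : (ZMod (2 ^ k))ˣ) (j : Fin π.nb), τ k (-(b : ZMod (2 ^ k))) • d k j = -(τ k (b : ZMod (2 ^ k)) • d k j))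
    (hlog : haveI := isIntegral_genFib_baseChange 2 ((WeierstrassCurve.integralModelInt W).map (Int.castRingHom ℤ_[2]))
      ∀ (m : ℕ) (Q₀ : localPoints W ℚ_[2]),
        WeierstrassCurve.Affine.Point.map (W' := W)
            (Φ : AlgebraicClosure ℚ_[2] →ₐ[ℚ] AlgebraicClosure (π.v.adicCompletion ℚ))
            (show (W.baseChange (AlgebraicClosure ℚ_[2])).toAffine.Point from Q₀) ∈
          localLayerPointsOfEmb κ (closureEmb (K := ℚ) (π.v.adicCompletion ℚ)) W m →
        (toLoc ((genFibΩ_eq_baseChange ((WeierstrassCurve.integralModelInt W).map (Int.castRingHom ℤ_[2]))).trans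
          (baseChange_twoAdicModel W))).symm Q₀ ∈
          kernel (Valued.v (R := PadicAlgCl 2)) (genFibΩ 2 ((WeierstrassCurve.integralModelInt W).map (Int.castRingHom ℤ_[2]))) →
        ∀ b : (ZMod (2 ^ (m + 2)))ˣ,
          τ (m + 2) (-(b : ZMod (2 ^ (m + 2)))) •
              ptLogΩ 2 ((WeierstrassCurve.integralModelInt W).map (Int.castRingHom ℤ_[2]))
                ((toLoc ((genFibΩ_eq_baseChange ((WeierstrassCurve.integralModelInt W).map (Int.castRingHom ℤ_[2]))).trans
                  (baseChange_twoAdicModel W))).symm Q₀) =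
            τ (m + 2) (b : ZMod (2 ^ (m + 2))) •
              ptLogΩ 2 ((WeierstrassCurve.integralModelInt W).map (Int.castRingHom ℤ_[2]))
                ((toLoc ((genFibΩ_eq_baseChange ((WeierstrassCurve.integralModelInt W).map (Int.castRingHom ℤ_[2]))).trans
                  (baseChange_twoAdicModel W))).symm Q₀))
    (h : π.KatoBKCoord Φ τ z c' w) : π.KatoBKCoord Φ τ z c' (w + d) := by
  intro a m i Q₀ hQv hker
  haveI : NeZero (2 ^ (m + 2)) := ⟨pow_ne_zero _ two_ne_zero⟩
  rw [h a m i Q₀ hQv hker]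
  refine Finset.sum_congr rfl fun j _ => ?_
  congr 1
  have hL := hlog m Q₀ hQv hker
  have h0 := sum_units_eq_zero_of_odd (A := PadicAlgCl 2) (two_ne_zero' (PadicAlgCl 2))
    (fun b : (ZMod (2 ^ (m + 2)))ˣ => τ (m + 2) (b : ZMod (2 ^ (m + 2))) •
      (ptLogΩ 2 ((WeierstrassCurve.integralModelInt W).map (Int.castRingHom ℤ_[2]))
          ((toLoc ((genFibΩ_eq_baseChange ((WeierstrassCurve.integralModelInt W).map (Int.castRingHom ℤ_[2]))).trans
            (baseChange_twoAdicModel W))).symm Q₀) * d (m + 2) j)) fun b => by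
      simp only [Units.val_neg, smul_mul', hL b, hd, mul_neg]
  simp only [Pi.add_apply, mul_add, smul_add, Finset.sum_add_distrib, h0, add_zero]

/-- **(iii) PROVED: the odd gauge acts on valued classes** (log-evenness displayed; automatic at frames) — `(z, c′, q, μ̃)` and hence `λ(Λ/μ̃)`
are untouched, so (G7) is HARMLESS for the ∀-child-B at frames; k4-g31's generator list (G1)(G1′)(G2)(G3)(G5) + (G7) is the census to date. -/
theorem katoValuedClass_add_odd [W.IsGloballyMinimal] {Φ : AlgebraicClosure ℚ_[2] ≃ₐ[ℚ] AlgebraicClosure (π.v.adicCompletion ℚ)}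
    {τ : ∀ m : ℕ, ZMod (2 ^ m) → Field.absoluteGaloisGroup ℚ_[2]} {z : I.H} {c' : Fin n → ↥(padicCoeffIntegers S)}
    {w d : ℕ → Fin π.nb → PadicAlgCl 2} {q : PadicAlgCl 2} {μt : IwasawaAlgebraO S}
    (hd : ∀ (k : ℕ) (b : (ZMod (2 ^ k))ˣ) (j : Fin π.nb), τ k (-(b : ZMod (2 ^ k))) • d k j = -(τ k (b : ZMod (2 ^ k)) • d k j))
    (hlog : haveI := isIntegral_genFib_baseChange 2 ((WeierstrassCurve.integralModelInt W).map (Int.castRingHom ℤ_[2]))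
      ∀ (m : ℕ) (Q₀ : localPoints W ℚ_[2]),
        WeierstrassCurve.Affine.Point.map (W' := W)
            (Φ : AlgebraicClosure ℚ_[2] →ₐ[ℚ] AlgebraicClosure (π.v.adicCompletion ℚ))
            (show (W.baseChange (AlgebraicClosure ℚ_[2])).toAffine.Point from Q₀) ∈
          localLayerPointsOfEmb κ (closureEmb (K := ℚ) (π.v.adicCompletion ℚ)) W m →
        (toLoc ((genFibΩ_eq_baseChange ((WeierstrassCurve.integralModelInt W).map (Int.castRingHom ℤ_[2]))).trans
          (baseChange_twoAdicModel W))).symm Q₀ ∈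
          kernel (Valued.v (R := PadicAlgCl 2)) (genFibΩ 2 ((WeierstrassCurve.integralModelInt W).map (Int.castRingHom ℤ_[2]))) →
        ∀ b : (ZMod (2 ^ (m + 2)))ˣ,
          τ (m + 2) (-(b : ZMod (2 ^ (m + 2)))) •
              ptLogΩ 2 ((WeierstrassCurve.integralModelInt W).map (Int.castRingHom ℤ_[2]))
                ((toLoc ((genFibΩ_eq_baseChange ((WeierstrassCurve.integralModelInt W).map (Int.castRingHom ℤ_[2]))).trans
                  (baseChange_twoAdicModel W))).symm Q₀) =
            τ (m + 2) (b : ZMod (2 ^ (m + 2))) •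
              ptLogΩ 2 ((WeierstrassCurve.integralModelInt W).map (Int.castRingHom ℤ_[2]))
                ((toLoc ((genFibΩ_eq_baseChange ((WeierstrassCurve.integralModelInt W).map (Int.castRingHom ℤ_[2]))).trans
                  (baseChange_twoAdicModel W))).symm Q₀))
    (hc : π.KatoValuedClass g ι Ω Φ τ z c' w q μt) : π.KatoValuedClass g ι Ω Φ τ z c' (w + d) q μt :=
  ⟨hc.1, hc.2.1, hc.2.2.1, katoBKCoord_add_odd π hd hlog hc.2.2.2.1, katoValCoord_add_odd π g ι Ω hd hc.2.2.2.2.1,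
    katoTrivCoord_add_odd π g ι Ω hd hc.2.2.2.2.2⟩

/-! ## §3 The repair, typed: (T4) at FRAMES -/

/-- k1-g34's (T4) `RatioRelationStatement` restated VERBATIM in shape (bare `Φ`, bare `τ`) — for comparison only; nothing asserted. -/
def RatioRelationAllTau [W.IsGloballyMinimal] : Prop :=
  ∀ (Φ : AlgebraicClosure ℚ_[2] ≃ₐ[ℚ] AlgebraicClosure (π.v.adicCompletion ℚ))
    (τ : ∀ m : ℕ, ZMod (2 ^ m) → Field.absoluteGaloisGroup ℚ_[2])
    (z z' : I.H) (c' c'' : Fin n → ↥(padicCoeffIntegers S)) (w w' : ℕ → Fin π.nb → PadicAlgCl 2) (q q' : PadicAlgCl 2)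
    (μt μt' : IwasawaAlgebraO S),
    π.KatoValuedClass g ι Ω Φ τ z c' w q μt → π.KatoValuedClass g ι Ω Φ τ z' c'' w' q' μt' →
    ∀ s₁ s₂ : IwasawaAlgebraO S, s₁ ≠ 0 → s₂ ≠ 0 → s₁ • z = s₂ • z' →
      ∃ a a' : ↥(padicCoeffIntegers S), a ≠ 0 ∧ a' ≠ 0 ∧
        (PowerSeries.C a : IwasawaAlgebraO S) * μt * s₁ = (PowerSeries.C a' : IwasawaAlgebraO S) * μt' * s₂

/-- **(T4F) THE RATIO RELATION AT FRAMES — the repaired station (TYPED; nothing asserted; M-sized).** Same text with the binder of the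
∀-child-B leaf `stub_kzgChildB` (v9) and of station (R): `F : π.KatoFrame`, classes at `F.Φ, F.τ`.  Proof route (k1-g31 PLAN 1 steps 3–5): two
calls of `StationR.values_identity` at the common frame (uniform `(δ, U)` in `m`), `Θ*`-vanishing at even primitive `ψ` ((Θ), landed in R4b's
proof), subtraction along `s₁•z = s₂•z′` through the `Λ_𝒪`-semilinearity of `e ∘ 𝒸`, and the identity principle `StationR.finite_setOf_tsum_eq_zero` (P).
[cite: Kato2004Asterisque, Thm. 12.5 (1) (pp. 221–222), Thm. 16.6 (2) (p. 252)] [cite: Rohrlich1984, Theorem (p. 409)] [cite: Washington1997, §7.2] -/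
def RatioRelationAtFrames [W.IsGloballyMinimal] : Prop :=
  ∀ (F : π.KatoFrame)
    (z z' : I.H) (c' c'' : Fin n → ↥(padicCoeffIntegers S)) (w w' : ℕ → Fin π.nb → PadicAlgCl 2) (q q' : PadicAlgCl 2)
    (μt μt' : IwasawaAlgebraO S),
    π.KatoValuedClass g ι Ω F.Φ F.τ z c' w q μt → π.KatoValuedClass g ι Ω F.Φ F.τ z' c'' w' q' μt' →
    ∀ s₁ s₂ : IwasawaAlgebraO S, s₁ ≠ 0 → s₂ ≠ 0 → s₁ • z = s₂ • z' →
      ∃ a a' : ↥(padicCoeffIntegers S), a ≠ 0 ∧ a' ≠ 0 ∧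
        (PowerSeries.C a : IwasawaAlgebraO S) * μt * s₁ = (PowerSeries.C a' : IwasawaAlgebraO S) * μt' * s₂

/-- The bare-`τ` station implies the frame station (the converse is the content of (i)–(iii): it would need the value relations at scrambled
index families, which nobody consumes). -/
theorem ratioRelationAtFrames_of_allTau [W.IsGloballyMinimal] (h : RatioRelationAllTau π g ι Ω) : RatioRelationAtFrames π g ι Ω :=
  fun F => h F.Φ F.τ

/-- **At the frames, (i) shows the bare-`τ` station already covers the non-frames `F.τ ∘ neg` for free** — (T4) at `F.τ∘neg` is (T4) at `F.τ`. -/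
theorem ratioRelation_at_reindex_neg_of_atFrames [W.IsGloballyMinimal] (h : RatioRelationAtFrames π g ι Ω) (F : π.KatoFrame)
    (z z' : I.H) (c' c'' : Fin n → ↥(padicCoeffIntegers S)) (w w' : ℕ → Fin π.nb → PadicAlgCl 2) (q q' : PadicAlgCl 2)
    (μt μt' : IwasawaAlgebraO S)
    (hc : π.KatoValuedClass g ι Ω F.Φ (fun k c => F.τ k (-c)) z c' w q μt)
    (hc' : π.KatoValuedClass g ι Ω F.Φ (fun k c => F.τ k (-c)) z' c'' w' q' μt') :
    ∀ s₁ s₂ : IwasawaAlgebraO S, s₁ ≠ 0 → s₂ ≠ 0 → s₁ • z = s₂ • z' →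
      ∃ a a' : ↥(padicCoeffIntegers S), a ≠ 0 ∧ a' ≠ 0 ∧
        (PowerSeries.C a : IwasawaAlgebraO S) * μt * s₁ = (PowerSeries.C a' : IwasawaAlgebraO S) * μt' * s₂ :=
  h F z z' c' c'' w w' q q' μt μt' ((katoValuedClass_reindex_neg_iff π g ι Ω F.Φ F.τ z c' w q μt).mp hc)
    ((katoValuedClass_reindex_neg_iff π g ι Ω F.Φ F.τ z' c'' w' q' μt').mp hc')

end Tree

end Summit.BirchSwinnertonDyer.BirchSwinnertonDyer.Cruxes.ResidualThetaCountLowerPureAtTwo.SideaK4G32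

end
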